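import Summits.KontsevichZagierPeriods.KontsevichZagierPeriods.Theorems.RootDecompZetaThreeFrontierGZLadderFourPolarP12

/-! # `RootDecompZetaThreeFrontierGZLadderFourPolarP12` — part 12/12 of the mechanical ≤400-line split of `l4_src.lean` (sha256 5cc5a9ee4c47da9a…)
Source: decomp-kz lens-1 g13 Layer4_v1.lean @897236f9 minus the RungFour prelude block (imported from …RungFourPreludeP14); --supports stmt-KontsevichZagierPeriods-27141.
Split by census-1 g10 `gen/splitlean.py`: scopes re-opened with their `open`/`variable`/`set_option` context; mathematics and declaration order unchanged. -/

set_option linter.dupNamespace false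
noncomputable section
set_option linter.dupNamespace false
set_option linter.unusedVariables false
set_option linter.unusedSectionVars false
set_option linter.unusedSimpArgs false
open Set MeasureTheory MvPolynomial
open Literature.NumberTheory.Transcendental
open Summit.KontsevichZagierPeriods.KontsevichZagierPeriods.Theorems.RootDecompZetaThreeFrontierWordMoves
open Summit.KontsevichZagierPeriods.KontsevichZagierPeriods.Cruxes.GZNormalFormWThree.GZLadder.RungThree (congInto_mono congInto_of_mem_closure congInto_of_sub_mem)

namespace Summit.KontsevichZagierPeriods.KontsevichZagierPeriods.Cruxes.GZNormalFormWThree.GZLadder.LayerFour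
open Summit.KontsevichZagierPeriods.KontsevichZagierPeriods.Cruxes.GZNormalFormWThree.GZLadder.RungFour
open Summit.KontsevichZagierPeriods.KontsevichZagierPeriods.Cruxes.GZNormalFormWThree.GZLadder.WlogFour
open Summit.KontsevichZagierPeriods.KontsevichZagierPeriods.Cruxes.GZNormalFormWThree.GZLadder.MatchFour
open Summit.KontsevichZagierPeriods.KontsevichZagierPeriods.Cruxes.GZNormalFormWThree.GZLadder.GapForm
open Literature.ModelTheory.ExponentialFields (IsSemialgebraic)

open Set MeasureTheory MvPolynomial in
open Literature.NumberTheory.Transcendental in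
open Summit.KontsevichZagierPeriods.KontsevichZagierPeriods.Theorems.RootDecompZetaThreeFrontierWordMoves in
open Summit.KontsevichZagierPeriods.KontsevichZagierPeriods.Cruxes.GZNormalFormWThree.GZLadder.RungThree (congInto_mono congInto_of_mem_closure congInto_of_sub_mem) in
open Summit.KontsevichZagierPeriods.KontsevichZagierPeriods.Cruxes.GZNormalFormWThree.GZLadder.RungFour in
open Summit.KontsevichZagierPeriods.KontsevichZagierPeriods.Cruxes.GZNormalFormWThree.GZLadder.WlogFour in
open Summit.KontsevichZagierPeriods.KontsevichZagierPeriods.Cruxes.GZNormalFormWThree.GZLadder.MatchFour in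
open Summit.KontsevichZagierPeriods.KontsevichZagierPeriods.Cruxes.GZNormalFormWThree.GZLadder.GapForm in
open Literature.ModelTheory.ExponentialFields (IsSemialgebraic) in
/-- Auxiliary step `vec4_3` (§L4): vec4 3. [bookkeeping] -/
private theorem vec4_3 (a b c d : ℝ) : (![a, b, c, d] : Fin 4 → ℝ) 3 = d := rfl

open Set MeasureTheory MvPolynomial in
open Literature.NumberTheory.Transcendental in
open Summit.KontsevichZagierPeriods.KontsevichZagierPeriods.Theorems.RootDecompZetaThreeFrontierWordMoves in
open Summit.KontsevichZagierPeriods.KontsevichZagierPeriods.Cruxes.GZNormalFormWThree.GZLadder.RungThree (congInto_mono congInto_of_mem_closure congInto_of_sub_mem) in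
open Summit.KontsevichZagierPeriods.KontsevichZagierPeriods.Cruxes.GZNormalFormWThree.GZLadder.RungFour in
open Summit.KontsevichZagierPeriods.KontsevichZagierPeriods.Cruxes.GZNormalFormWThree.GZLadder.WlogFour in
open Summit.KontsevichZagierPeriods.KontsevichZagierPeriods.Cruxes.GZNormalFormWThree.GZLadder.MatchFour in
open Summit.KontsevichZagierPeriods.KontsevichZagierPeriods.Cruxes.GZNormalFormWThree.GZLadder.GapForm in
open Literature.ModelTheory.ExponentialFields (IsSemialgebraic) in
/-- Auxiliary step `vec4_2` (§L4): vec4 2. [bookkeeping] -/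
private theorem vec4_2 (a b c d : ℝ) : (![a, b, c, d] : Fin 4 → ℝ) 2 = c := rfl

open Set MeasureTheory MvPolynomial in
open Literature.NumberTheory.Transcendental in
open Summit.KontsevichZagierPeriods.KontsevichZagierPeriods.Theorems.RootDecompZetaThreeFrontierWordMoves in
open Summit.KontsevichZagierPeriods.KontsevichZagierPeriods.Cruxes.GZNormalFormWThree.GZLadder.RungThree (congInto_mono congInto_of_mem_closure congInto_of_sub_mem) in
open Summit.KontsevichZagierPeriods.KontsevichZagierPeriods.Cruxes.GZNormalFormWThree.GZLadder.RungFour in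
open Summit.KontsevichZagierPeriods.KontsevichZagierPeriods.Cruxes.GZNormalFormWThree.GZLadder.WlogFour in
open Summit.KontsevichZagierPeriods.KontsevichZagierPeriods.Cruxes.GZNormalFormWThree.GZLadder.MatchFour in
open Summit.KontsevichZagierPeriods.KontsevichZagierPeriods.Cruxes.GZNormalFormWThree.GZLadder.GapForm in
open Literature.ModelTheory.ExponentialFields (IsSemialgebraic) in
/-- Auxiliary step `vec4_1` (§L4): vec4 1. [bookkeeping] -/
private theorem vec4_1 (a b c d : ℝ) : (![a, b, c, d] : Fin 4 → ℝ) 1 = b := rfl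

open Set MeasureTheory MvPolynomial in
open Literature.NumberTheory.Transcendental in
open Summit.KontsevichZagierPeriods.KontsevichZagierPeriods.Theorems.RootDecompZetaThreeFrontierWordMoves in
open Summit.KontsevichZagierPeriods.KontsevichZagierPeriods.Cruxes.GZNormalFormWThree.GZLadder.RungThree (congInto_mono congInto_of_mem_closure congInto_of_sub_mem) in
open Summit.KontsevichZagierPeriods.KontsevichZagierPeriods.Cruxes.GZNormalFormWThree.GZLadder.RungFour in
open Summit.KontsevichZagierPeriods.KontsevichZagierPeriods.Cruxes.GZNormalFormWThree.GZLadder.WlogFour in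
open Summit.KontsevichZagierPeriods.KontsevichZagierPeriods.Cruxes.GZNormalFormWThree.GZLadder.MatchFour in
open Summit.KontsevichZagierPeriods.KontsevichZagierPeriods.Cruxes.GZNormalFormWThree.GZLadder.GapForm in
open Literature.ModelTheory.ExponentialFields (IsSemialgebraic) in
/-- Auxiliary step `vec4_0` (§L4): vec4 0. [bookkeeping] -/
private theorem vec4_0 (a b c d : ℝ) : (![a, b, c, d] : Fin 4 → ℝ) 0 = a := rfl

/-- Auxiliary step `layU_cont`: lay U cont. [bookkeeping] -/
theorem layU_cont (Q : MvPolynomial (Fin 4) ℚ) (β0 β1 β2 γ1 γ2 γ3 α02 α03 α13 : ℕ) : ∀ y ∈ KZ.openOrderedSimplex 3,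
    ContinuousOn (fun s => layU Q β0 β1 β2 γ1 γ2 γ3 α02 α03 α13 (Fin.snoc y s)) (Icc (y (Fin.last 2)) (y 1)) := by
  intro y hy
  obtain ⟨h2, h21, h10, h0⟩ := (mem_simplex_three_iff y).1 hy
  show ContinuousOn (fun s => MvPolynomial.aeval (Fin.snoc y s : Fin 4 → ℝ) Q /
    (y 0 ^ β0 * y 1 ^ β1 * s ^ β2 * (1 - y 1) ^ γ1 * (1 - s) ^ γ2 * (1 - y 2) ^ γ3 * (y 0 - s) ^ α02 * (y 0 - y 2) ^ α03 *
      (y 1 - y 2) ^ α13)) (Icc (y 2) (y 1))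
  refine ContinuousOn.div (continuous_aeval_snoc4 y Q).continuousOn (by fun_prop) fun s hs => ?_
  have hs0 : y 2 ≤ s := hs.1
  have hs1 : s ≤ y 1 := hs.2
  have a0 : y 0 ≠ 0 := by linarith
  have a1 : y 1 ≠ 0 := by linarith
  have a2 : s ≠ 0 := by linarith
  have a3 : (1 : ℝ) - y 1 ≠ 0 := by linarith
  have a4 : (1 : ℝ) - s ≠ 0 := by linarith
  have a5 : (1 : ℝ) - y 2 ≠ 0 := by linarith
  have a6 : y 0 - s ≠ 0 := by linarith
  have a7 : y 0 - y 2 ≠ 0 := by linarith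
  have a8 : y 1 - y 2 ≠ 0 := by linarith
  exact mul_ne_zero (mul_ne_zero (mul_ne_zero (mul_ne_zero (mul_ne_zero (mul_ne_zero (mul_ne_zero (mul_ne_zero
    (pow_ne_zero _ a0) (pow_ne_zero _ a1)) (pow_ne_zero _ a2)) (pow_ne_zero _ a3)) (pow_ne_zero _ a4)) (pow_ne_zero _ a5))
    (pow_ne_zero _ a6)) (pow_ne_zero _ a7)) (pow_ne_zero _ a8)

/-- **`∂_{u₃} (Q/den) = ibpQ2(Q)/den(…,β₂+1,…,γ₂+1,…,α₀₂+1,…)`** on the fibres `u₂ < u₃ < u₁` -/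
theorem layU_der (Q : MvPolynomial (Fin 4) ℚ) (β0 β1 β2 γ1 γ2 γ3 α02 α03 α13 : ℕ) :
    ∀ y ∈ KZ.openOrderedSimplex 3, ∀ t ∈ Ioo (y (Fin.last 2)) (y 1),
    HasDerivAt (fun s => layU Q β0 β1 β2 γ1 γ2 γ3 α02 α03 α13 (Fin.snoc y s))
      (layU (ibpQ2 Q β2 γ2 α02) β0 β1 (β2 + 1) γ1 (γ2 + 1) γ3 (α02 + 1) α03 α13 (Fin.snoc y t)) t := by
  intro y hy t ht
  obtain ⟨h2, h21, h10, h0⟩ := (mem_simplex_three_iff y).1 hy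
  have ht0 : y 2 < t := ht.1
  have ht1 : t < y 1 := ht.2
  have a0 : y 0 ≠ 0 := by linarith
  have a1 : y 1 ≠ 0 := by linarith
  have hs : t ≠ 0 := by linarith
  have a3 : (1 : ℝ) - y 1 ≠ 0 := by linarith
  have hu : (1 : ℝ) - t ≠ 0 := by linarith
  have a5 : (1 : ℝ) - y 2 ≠ 0 := by linarith
  have hv : y 0 - t ≠ 0 := by linarith
  have a7 : y 0 - y 2 ≠ 0 := by linarith
  have a8 : y 1 - y 2 ≠ 0 := by linarith
  have hN := hasDerivAt_aeval_snoc4 y t Q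
  have hE1 : HasDerivAt (fun s : ℝ => s ^ β2) ((β2 : ℝ) * t ^ (β2 - 1)) t := hasDerivAt_pow β2 t
  have hE2 : HasDerivAt (fun s : ℝ => (1 - s) ^ γ2) ((γ2 : ℝ) * (1 - t) ^ (γ2 - 1) * (-1)) t :=
    ((hasDerivAt_id t).const_sub 1).pow γ2
  have hE3 : HasDerivAt (fun s : ℝ => (y 0 - s) ^ α02) ((α02 : ℝ) * (y 0 - t) ^ (α02 - 1) * (-1)) t :=
    ((hasDerivAt_id t).const_sub (y 0)).pow α02
  have hDen := ((((((hE1.const_mul (y 0 ^ β0 * y 1 ^ β1)).mul_const ((1 - y 1) ^ γ1)).mul hE2).mul_const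
    ((1 - y 2) ^ γ3)).mul hE3).mul_const ((y 0 - y 2) ^ α03)).mul_const ((y 1 - y 2) ^ α13)
  have hne : y 0 ^ β0 * y 1 ^ β1 * t ^ β2 * (1 - y 1) ^ γ1 * (1 - t) ^ γ2 * (1 - y 2) ^ γ3 * (y 0 - t) ^ α02 * (y 0 - y 2) ^ α03 *
      (y 1 - y 2) ^ α13 ≠ 0 :=
    mul_ne_zero (mul_ne_zero (mul_ne_zero (mul_ne_zero (mul_ne_zero (mul_ne_zero (mul_ne_zero (mul_ne_zero
      (pow_ne_zero _ a0) (pow_ne_zero _ a1)) (pow_ne_zero _ hs)) (pow_ne_zero _ a3)) (pow_ne_zero _ hu)) (pow_ne_zero _ a5))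
      (pow_ne_zero _ hv)) (pow_ne_zero _ a7)) (pow_ne_zero _ a8)
  have h := hN.div hDen hne
  show HasDerivAt (fun s => MvPolynomial.aeval (Fin.snoc y s : Fin 4 → ℝ) Q /
    (y 0 ^ β0 * y 1 ^ β1 * s ^ β2 * (1 - y 1) ^ γ1 * (1 - s) ^ γ2 * (1 - y 2) ^ γ3 * (y 0 - s) ^ α02 * (y 0 - y 2) ^ α03 *
      (y 1 - y 2) ^ α13)) _ t
  refine h.congr_deriv ?_
  simp only [Pi.mul_apply]
  rw [Summit.KontsevichZagierPeriods.RootDecompZetaThreeFrontier.WordLayer.natCast_mul_pow_pred β2 t hs,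
    Summit.KontsevichZagierPeriods.RootDecompZetaThreeFrontier.WordLayer.natCast_mul_pow_pred γ2 (1 - t) hu,
    Summit.KontsevichZagierPeriods.RootDecompZetaThreeFrontier.WordLayer.natCast_mul_pow_pred α02 (y 0 - t) hv]
  simp only [layU, ibpQ2, map_add, map_sub, map_mul, map_natCast, MvPolynomial.aeval_X, MvPolynomial.aeval_C, map_one,
    snoc3_zero, snoc3_one, snoc3_two, snoc3_three]
  field_simp
  ring

/-- **THE t₂-IBP MOVE**: `[Δ₄, sw4P(ibpQ2 Q)/den(β₀,β₁,β₂+1,γ₁,γ₂+1,γ₃,α₀₂+1,α₀₃,α₁₃)] ≡ [Δ₃, ibpB2(Q)/(common denominator)]`. -/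
theorem ibpT2 (Q : MvPolynomial (Fin 4) ℚ) (β0 β1 β2 γ1 γ2 γ3 α02 α03 α13 : ℕ) (r : KZ.IntegralRep 4)
    (hd : r.domain = KZ.openOrderedSimplex 4)
    (hi : EqOn r.integrand (layF (sw4P (ibpQ2 Q β2 γ2 α02)) β0 β1 (β2 + 1) γ1 (γ2 + 1) γ3 (α02 + 1) α03 α13) r.domain) :
    ∃ r' : KZ.IntegralRep 3, r'.domain = KZ.openOrderedSimplex 3 ∧
      EqOn r'.integrand (fun y => MvPolynomial.aeval y (ibpB2 Q β2 γ2 α02) /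
        (y 0 ^ β0 * y 1 ^ (β1 + β2) * y 2 ^ β2 * (1 - y 1) ^ (γ1 + γ2) * (1 - y 2) ^ (γ2 + γ3) * (y 0 - y 1) ^ α02 *
          (y 0 - y 2) ^ (α02 + α03) * (y 1 - y 2) ^ α13)) r'.domain ∧
      KZ.of r - KZ.of r' ∈ KZ.relations := by
  obtain ⟨r', hd', hi', hrel⟩ := nlDir2 (layU_sa_band2 (ibpQ2 Q β2 γ2 α02) β0 β1 (β2 + 1) γ1 (γ2 + 1) γ3 (α02 + 1) α03 α13)
    (layU_sa_band2 Q β0 β1 β2 γ1 γ2 γ3 α02 α03 α13) (layU_cont Q β0 β1 β2 γ1 γ2 γ3 α02 α03 α13)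
    (layU_der Q β0 β1 β2 γ1 γ2 γ3 α02 α03 α13) r hd (fun t ht => by rw [hi ht, ← layU_sw4])
  refine ⟨r', hd', fun y hy => ?_, hrel⟩
  rw [hd'] at hy
  obtain ⟨h2, h21, h10, h0⟩ := (mem_simplex_three_iff y).1 hy
  have a0 : y 0 ≠ 0 := by linarith
  have a1 : y 1 ≠ 0 := by linarith
  have a2 : y 2 ≠ 0 := by linarith
  have a3 : (1 : ℝ) - y 1 ≠ 0 := by linarith
  have a4 : (1 : ℝ) - y 2 ≠ 0 := by linarith
  have a6 : y 0 - y 2 ≠ 0 := by linarith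
  have a7 : y 0 - y 1 ≠ 0 := by linarith
  have a8 : y 1 - y 2 ≠ 0 := by linarith
  rw [hi']
  have e1 : (Fin.snoc y (y 1) : Fin 4 → ℝ) = ![y 0, y 1, y 2, y 1] := by
    funext i; fin_cases i <;> rfl
  have e0 : (Fin.snoc y (y (Fin.last 2)) : Fin 4 → ℝ) = ![y 0, y 1, y 2, y 2] := by
    funext i; fin_cases i <;> rfl
  have g1 : (fun i => MvPolynomial.aeval y ((![MvPolynomial.X 0, MvPolynomial.X 1, MvPolynomial.X 2, MvPolynomial.X 1] :
      Fin 4 → MvPolynomial (Fin 3) ℚ) i)) = ![y 0, y 1, y 2, y 1] := by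
    funext i; fin_cases i <;> simp
  have g0 : (fun i => MvPolynomial.aeval y ((![MvPolynomial.X 0, MvPolynomial.X 1, MvPolynomial.X 2, MvPolynomial.X 2] :
      Fin 4 → MvPolynomial (Fin 3) ℚ) i)) = ![y 0, y 1, y 2, y 2] := by
    funext i; fin_cases i <;> simp
  show layU Q β0 β1 β2 γ1 γ2 γ3 α02 α03 α13 (Fin.snoc y (y 1)) -
    layU Q β0 β1 β2 γ1 γ2 γ3 α02 α03 α13 (Fin.snoc y (y (Fin.last 2))) = _
  rw [e1, e0]
  simp only [layU, ibpB2, map_sub, map_mul, map_pow, MvPolynomial.aeval_bind₁, g1, g0, MvPolynomial.aeval_X, map_one,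
    vec4_0, vec4_1, vec4_2, vec4_3]
  field_simp
  ring

/-- **THE t₂-IBP ENGINE in route vocabulary**: every `t₂`-exact class `sw4P(ibpQ2 Q β₂ γ₂ α₀₂)/den(β₀,β₁,β₂+1,γ₁,γ₂+1,γ₃,α₀₂+1,α₀₃,α₁₃)`
on `Δ₄` is congruent to ONE genus-zero datum of dimension `3`, hence `CongInto (gzLT 4)`. -/
theorem congInto_of_ibpT2 (Q : MvPolynomial (Fin 4) ℚ) (β0 β1 β2 γ1 γ2 γ3 α02 α03 α13 : ℕ) (r : KZ.IntegralRep 4)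
    (hd : r.domain = simplex 4)
    (hi : EqOn r.integrand (layF (sw4P (ibpQ2 Q β2 γ2 α02)) β0 β1 (β2 + 1) γ1 (γ2 + 1) γ3 (α02 + 1) α03 α13) r.domain) :
    CongInto (gzLT 4) (KZ.of r) := by
  obtain ⟨r', hd', hi', hrel⟩ := ibpT2 Q β0 β1 β2 γ1 γ2 γ3 α02 α03 α13 r hd hi
  have h01 : ((0 : Fin 3) < 1) = True := eq_true (by decide)
  have h02 : ((0 : Fin 3) < 2) = True := eq_true (by decide)
  have h12 : ((1 : Fin 3) < 2) = True := eq_true (by decide)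
  refine congInto_of_sub_mem hrel (congInto_self ⟨3, r', by norm_num, ⟨hd', ibpB2 Q β2 γ2 α02,
    ![![0, α02, α02 + α03], ![0, 0, α13], ![0, 0, 0]], ![β0, β1 + β2, β2], ![0, γ1 + γ2, γ2 + γ3], fun y hy => ?_⟩, rfl⟩)
  rw [hi' hy]
  simp only [Fin.prod_univ_three, Matrix.cons_val_zero, Matrix.cons_val_one, Matrix.head_cons, Matrix.cons_val_two,
    Matrix.tail_cons, h01, h02, h12, if_true, pow_zero, ite_self, mul_one, one_mul]
  ring

/-- **THE t₁-IBP ENGINE** (the t₂-engine conjugated by `σ₄`). -/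
theorem congInto_of_ibpT1 (Q : MvPolynomial (Fin 4) ℚ) (β0 β1 β2 γ1 γ2 γ3 α02 α03 α13 : ℕ) (r : KZ.IntegralRep 4)
    (hd : r.domain = simplex 4)
    (hi : EqOn r.integrand (layF (du4P (sw4P (ibpQ2 Q β2 γ2 α02))) γ3 (γ2 + 1) γ1 (β2 + 1) β1 β0 α13 α03 (α02 + 1)) r.domain) :
    CongInto (gzLT 4) (KZ.of r) := by
  refine congInto_of_dual4 _ r hd (congInto_of_ibpT2 Q β0 β1 β2 γ1 γ2 γ3 α02 α03 α13 (dualRep4 r hd) rfl fun t ht => ?_)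
  rw [dualRep4_integrand, hi (by rw [hd]; exact mem_simplex_four_du4 ht), ← layF_du4, du4_du4]

end Summit.KontsevichZagierPeriods.KontsevichZagierPeriods.Cruxes.GZNormalFormWThree.GZLadder.LayerFour

end
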